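import Summits.QuantumAdvantage.QuantumAdvantage.Theorems.SparsityDialMP3

/-!
# SparsityDial — part MP4 of 10 of the «MovingPointers» package (decomp-qadv lens 2, g18): §M2 m-fold twisted fibre sums; §M3 even cells (a third of all cells lose)

Imports its predecessor `SparsityDialMP3` (linear chain MP1 → … → MP10); the package overview is the module docstring of `SparsityDialMP1`.
No `sorry`; standard axioms; no instances / notation.
-/

set_option linter.unusedVariables false
set_option linter.dupNamespace false

noncomputable section
open scoped Classical

namespace Summit.QuantumAdvantage.QuantumAdvantage.Theorems.SparsityDial

open Finset
open Literature.Computability.QuantumComplexity Literature.Computability.QuantumComplexity.RingHLF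
open Literature.Computability.MetaComplexity Literature.Computability.MetaComplexity.Smolensky
open Summit.QuantumAdvantage.AdviceFreeQNC0
open Summit.QuantumAdvantage.QuantumAdvantage.Theorems.HolonomyDial (gCond)
open Summit.QuantumAdvantage.QuantumAdvantage.Theorems.LocusDial
open Summit.QuantumAdvantage.QuantumAdvantage.Theorems.AnchorDial (dev outB win_iff card_odd_ge)
open Summit.QuantumAdvantage.QuantumAdvantage.Theorems.HolonomyDial (card_odd_le)
open Summit.QuantumAdvantage.QuantumAdvantage.Theorems.StabilizerDial (eventually_polylog StabFew stabFew_of_fewLocus)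

/-! ## §M2  The m-fold twisted fibre sums and the `3^m` joint cells -/

section MultiFibre
variable {N t : ℕ}

/-- the m-fold twisted fibre sum `Σ_{x ∈ fib} χ(Σ_l α_l (φ_{k_l} − a_l))`. -/
def fibSumM (M : Fin t → Fin N → ZMod 3) (v : Fin t → ZMod 3) {m : ℕ} (α a : Fin m → ZMod 3) (k : Fin m → ℕ) : ℂ :=
  ∑ x ∈ fib M v, χ (∑ l : Fin m, α l * (kph x (k l) - a l))

/-- SparsityDial «MovingPointers» helper `kph_sum_expand` (decomp-qadv lens-2 g18 land package; see the module docstring). -/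
theorem kph_sum_expand (x : Fin N → Bool) {m : ℕ} (α a : Fin m → ZMod 3) (k : Fin m → ℕ) :
    (∑ l : Fin m, α l * (kph x (k l) - a l)) =
      (∑ l : Fin m, α l * (((Wk x (k l) : ℕ) : ZMod 3) + ((Wk x (N - 1) : ℕ) : ZMod 3))) +
        ∑ l : Fin m, (α l * ((k l + N : ℕ) : ZMod 3) - α l * a l) := by
  rw [← sum_add_distrib]
  apply sum_congr rfl
  intro l _
  exact kph_expand' x (k l) (α l) (a l)

/-- SparsityDial «MovingPointers» helper `fibSumM_expand` (decomp-qadv lens-2 g18 land package; see the module docstring). -/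
theorem fibSumM_expand (M : Fin t → Fin N → ZMod 3) (v : Fin t → ZMod 3) {m : ℕ} (α a : Fin m → ZMod 3)
    (k : Fin m → ℕ) :
    (3 : ℂ) ^ t * fibSumM M v α a k = ∑ lam : Fin t → ZMod 3,
      (∑ x ∈ (univ : Finset (Fin N → Bool)).filter (fun x => OddZeros x),
        χ ((∑ i : Fin N, (∑ s : Fin t, lam s * M s i) * (if x i then 1 else 0)) +
          ∑ l : Fin m, α l * (((Wk x (k l) : ℕ) : ZMod 3) + ((Wk x (N - 1) : ℕ) : ZMod 3)))) *
      χ ((∑ l : Fin m, (α l * ((k l + N : ℕ) : ZMod 3) - α l * a l)) - ∑ s : Fin t, lam s * v s) := by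
  unfold fibSumM fib
  rw [sum_filter, mul_sum]
  have hpt : ∀ x : Fin N → Bool,
      (3 : ℂ) ^ t * (if linHash M x = v then χ (∑ l : Fin m, α l * (kph x (k l) - a l)) else 0) =
      ∑ lam : Fin t → ZMod 3,
        χ ((∑ i : Fin N, (∑ s : Fin t, lam s * M s i) * (if x i then 1 else 0)) +
          ∑ l : Fin m, α l * (((Wk x (k l) : ℕ) : ZMod 3) + ((Wk x (N - 1) : ℕ) : ZMod 3))) *
        χ ((∑ l : Fin m, (α l * ((k l + N : ℕ) : ZMod 3) - α l * a l)) - ∑ s : Fin t, lam s * v s) := by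
    intro x
    have e : (if linHash M x = v then χ (∑ l : Fin m, α l * (kph x (k l) - a l)) else 0) =
        (if linHash M x = v then (1 : ℂ) else 0) * χ (∑ l : Fin m, α l * (kph x (k l) - a l)) := by
      split_ifs <;> simp
    rw [e, ← mul_assoc, fibre_indicator, sum_mul]
    apply sum_congr rfl
    intro lam _
    rw [← χ_add, ← χ_add, lam_hash, kph_sum_expand x α a k]
    congr 1
    ring
  simp_rw [hpt]
  rw [sum_comm]
  apply sum_congr rfl
  intro lam _
  rw [sum_mul]

/-- **m-fold twisted fibre bound**: `432·3^m·3^t·‖fibSumM‖ ≤ 2^N` for `α ≠ 0` (`8(t+m+3) + 20 ≤ j`). -/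
theorem fibSumM_bound (M : Fin t → Fin N → ZMod 3) (v : Fin t → ZMod 3) {m : ℕ} (α a : Fin m → ZMod 3)
    (hα : α ≠ 0) (k : Fin m → ℕ) (j : ℕ) (h2j : ∀ l, 2 * j ≤ k l) (hmono : ∀ l l' : Fin m, l ≤ l' → k l ≤ k l')
    (hgap : ∀ l l' : Fin m, l.val + 1 = l'.val → k l + 2 * j ≤ k l') (hkN : ∀ l, k l + 1 ≤ N)
    (hjt : 8 * (t + m + 3) + 20 ≤ j) :
    (432 : ℝ) * 3 ^ m * 3 ^ t * ‖fibSumM M v α a k‖ ≤ 2 ^ N := by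
  obtain ⟨l0, hl0⟩ := Function.ne_iff.mp hα
  have h2jN : 2 * j ≤ N := by have := h2j l0; have := hkN l0; omega
  have hexp := fibSumM_expand M v α a k
  set Z : (Fin t → ZMod 3) → ℂ := fun lam =>
      ∑ x ∈ (univ : Finset (Fin N → Bool)).filter (fun x => OddZeros x),
        χ ((∑ i : Fin N, (∑ s : Fin t, lam s * M s i) * (if x i then 1 else 0)) +
          ∑ l : Fin m, α l * (((Wk x (k l) : ℕ) : ZMod 3) + ((Wk x (N - 1) : ℕ) : ZMod 3))) with hZ
  have hnorm : (3 : ℝ) ^ t * ‖fibSumM M v α a k‖ ≤ ∑ lam : Fin t → ZMod 3, ‖Z lam‖ := by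
    have e3 : ‖(3 : ℂ) ^ t * fibSumM M v α a k‖ = (3 : ℝ) ^ t * ‖fibSumM M v α a k‖ := by
      rw [norm_mul, norm_pow]
      simp
    rw [← e3, hexp]
    refine (norm_sum_le _ _).trans ?_
    apply sum_le_sum
    intro lam _
    rw [norm_mul, norm_χ, mul_one]
  have hper : ∀ lam : Fin t → ZMod 3, (16 : ℝ) * 3 ^ (t + m + 3) * ‖Z lam‖ ≤ 2 ^ N :=
    fun lam => norm_of_normSq_budget (Z lam) (t + m + 3) N j h2jN hjt
      (normSq_appSumM_le (fun i => ∑ s : Fin t, lam s * M s i) α hα k j h2j hmono hgap hkN)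
  have hsum := sum_le_sum (fun lam (_ : lam ∈ (univ : Finset (Fin t → ZMod 3))) => hper lam)
  rw [← mul_sum, sum_const, card_univ, Fintype.card_fun, ZMod.card, Fintype.card_fin, nsmul_eq_mul] at hsum
  push_cast at hsum
  have h3pos : (0 : ℝ) < 3 ^ t := by positivity
  have e27 : (3 : ℝ) ^ (t + m + 3) = 27 * 3 ^ m * 3 ^ t := by rw [pow_add, pow_add]; norm_num; ring
  rw [e27] at hsum
  have hc : (3 : ℝ) ^ t * ((432 : ℝ) * 3 ^ m * 3 ^ t * ‖fibSumM M v α a k‖) ≤ 3 ^ t * 2 ^ N := by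
    have h16 : (0 : ℝ) ≤ 16 * (27 * 3 ^ m * 3 ^ t) := by positivity
    calc (3 : ℝ) ^ t * ((432 : ℝ) * 3 ^ m * 3 ^ t * ‖fibSumM M v α a k‖)
        = 16 * (27 * 3 ^ m * 3 ^ t) * (3 ^ t * ‖fibSumM M v α a k‖) := by ring
      _ ≤ 16 * (27 * 3 ^ m * 3 ^ t) * ∑ lam : Fin t → ZMod 3, ‖Z lam‖ := mul_le_mul_of_nonneg_left hnorm h16
      _ ≤ 3 ^ t * 2 ^ N := hsum
  exact le_of_mul_le_mul_left hc h3pos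

/-- **m-variable orthogonality on a fibre**: `3^m·#{x ∈ fib : ∀ l, φ_{k_l} = a_l} = Σ_α fibSumM`. -/
theorem cellM_count (M : Fin t → Fin N → ZMod 3) (v : Fin t → ZMod 3) {m : ℕ} (a : Fin m → ZMod 3) (k : Fin m → ℕ) :
    (((3 ^ m * ((fib M v).filter (fun x => ∀ l, kph x (k l) = a l)).card : ℕ)) : ℂ) =
      ∑ α : Fin m → ZMod 3, fibSumM M v α a k := by
  have hpt : ∀ x : Fin N → Bool, ∑ α : Fin m → ZMod 3, χ (∑ l : Fin m, α l * (kph x (k l) - a l)) =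
      if (∀ l, kph x (k l) = a l) then (3 : ℂ) ^ m else 0 := by
    intro x
    rw [sum_χ_lin m (fun l => kph x (k l) - a l)]
    by_cases h : ∀ l, kph x (k l) = a l
    · rw [if_pos h, if_pos]
      funext l
      simp [h l]
    · rw [if_neg h, if_neg]
      intro h0
      apply h
      intro l
      have := congrFun h0 l
      simpa [sub_eq_zero] using this
  have lhs : (((3 ^ m * ((fib M v).filter (fun x => ∀ l, kph x (k l) = a l)).card : ℕ)) : ℂ) =
      ∑ x ∈ fib M v, (if (∀ l, kph x (k l) = a l) then (3 : ℂ) ^ m else 0) := by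
    rw [sum_ite, sum_const_zero, add_zero, sum_const, nsmul_eq_mul]
    push_cast
    ring
  rw [lhs, sum_congr rfl (fun x _ => (hpt x).symm)]
  unfold fibSumM
  rw [sum_comm]

/-- SparsityDial «MovingPointers» helper `fibSumM_zero` (decomp-qadv lens-2 g18 land package; see the module docstring). -/
theorem fibSumM_zero (M : Fin t → Fin N → ZMod 3) (v : Fin t → ZMod 3) {m : ℕ} (a : Fin m → ZMod 3)
    (k : Fin m → ℕ) : fibSumM M v 0 a k = ((fib M v).card : ℂ) := by
  unfold fibSumM
  simp [χ_zero]

/-- every joint cell holds at least `#fib/3^m − B` once all non-trivially twisted sums are `≤ B`. -/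
theorem cellM_ge (M : Fin t → Fin N → ZMod 3) (v : Fin t → ZMod 3) {m : ℕ} (a : Fin m → ZMod 3) (k : Fin m → ℕ)
    (B : ℝ) (hB0 : 0 ≤ B) (hB : ∀ α : Fin m → ZMod 3, α ≠ 0 → ‖fibSumM M v α a k‖ ≤ B) :
    ((fib M v).card : ℝ) ≤ 3 ^ m * ((fib M v).filter (fun x => ∀ l, kph x (k l) = a l)).card + 3 ^ m * B := by
  have hc := cellM_count M v a k
  set F : (Fin m → ZMod 3) → ℂ := fun α => fibSumM M v α a k with hF
  have hsplit : ∑ α : Fin m → ZMod 3, F α =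
      F 0 + ∑ α ∈ (univ : Finset (Fin m → ZMod 3)).erase 0, F α :=
    (add_sum_erase _ F (mem_univ _)).symm
  have hF0 : F 0 = ((fib M v).card : ℂ) := fibSumM_zero M v a k
  have hcardle : (((univ : Finset (Fin m → ZMod 3)).erase 0).card : ℝ) ≤ 3 ^ m := by
    have h1 : ((univ : Finset (Fin m → ZMod 3)).erase 0).card ≤ (univ : Finset (Fin m → ZMod 3)).card :=
      card_erase_le
    rw [card_univ, Fintype.card_fun, ZMod.card, Fintype.card_fin] at h1
    exact_mod_cast h1
  have hrest : ‖∑ α ∈ (univ : Finset (Fin m → ZMod 3)).erase 0, F α‖ ≤ 3 ^ m * B := by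
    refine (norm_sum_le _ _).trans ?_
    have hle : ∀ α ∈ (univ : Finset (Fin m → ZMod 3)).erase 0, ‖F α‖ ≤ B :=
      fun α hα => hB α (ne_of_mem_erase hα)
    have := sum_le_sum hle
    rw [sum_const, nsmul_eq_mul] at this
    nlinarith [this, hcardle]
  have e : ((fib M v).card : ℂ) =
      (((3 ^ m * ((fib M v).filter (fun x => ∀ l, kph x (k l) = a l)).card : ℕ)) : ℂ) -
        ∑ α ∈ (univ : Finset (Fin m → ZMod 3)).erase 0, F α := by
    rw [hc]
    change _ = (∑ α : Fin m → ZMod 3, F α) - _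
    rw [hsplit, hF0]; ring
  have hn : ‖((fib M v).card : ℂ)‖ ≤
      ‖(((3 ^ m * ((fib M v).filter (fun x => ∀ l, kph x (k l) = a l)).card : ℕ)) : ℂ)‖ +
        ‖∑ α ∈ (univ : Finset (Fin m → ZMod 3)).erase 0, F α‖ := by
    rw [e]; exact norm_sub_le _ _
  rw [Complex.norm_natCast, Complex.norm_natCast] at hn
  push_cast at hn
  linarith

end MultiFibre

/-! ## §M3  The losing cells: EVEN number of good deviations; at least a third of all `3^m` cells -/

section EvenCells

/-- the cells `a ∈ 𝔽₃^m` with an EVEN number of coordinates `≠ 2` (= the losing phase patterns). -/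
def evenCells (m : ℕ) : Finset (Fin m → ZMod 3) :=
  univ.filter (fun a => Even ((univ : Finset (Fin m)).filter (fun l => a l ≠ 2)).card)

/-- toggling coordinate `0` between `2` and `≠ 2` maps odd cells to even cells at most two-to-one, so
`3^m ≤ 3·#evenCells` (`m ≥ 1`). -/
theorem three_mul_card_evenCells {m : ℕ} (hm : 1 ≤ m) : 3 ^ m ≤ 3 * (evenCells m).card := by
  set z : Fin m := ⟨0, by omega⟩ with hz
  set E := evenCells m with hE
  set O := (univ : Finset (Fin m → ZMod 3)).filter
    (fun a => ¬ Even ((univ : Finset (Fin m)).filter (fun l => a l ≠ 2)).card) with hO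
  let f : (Fin m → ZMod 3) → (Fin m → ZMod 3) := fun a => Function.update a z (if a z = 2 then 0 else 2)
  have hf_off : ∀ a (l : Fin m), l ≠ z → f a l = a l := by
    intro a l hl
    simp only [f, Function.update_apply, if_neg hl]
  have hf_z : ∀ a, f a z = (if a z = 2 then 0 else 2) := by
    intro a
    simp [f]
  -- parity flips under f
  have hflip : ∀ a : Fin m → ZMod 3,
      (Even ((univ : Finset (Fin m)).filter (fun l => f a l ≠ 2)).card ↔
        ¬ Even ((univ : Finset (Fin m)).filter (fun l => a l ≠ 2)).card) := by
    intro a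
    by_cases haz : a z = 2
    · have hset : (univ : Finset (Fin m)).filter (fun l => f a l ≠ 2) =
          insert z ((univ : Finset (Fin m)).filter (fun l => a l ≠ 2)) := by
        ext l
        rw [mem_insert, mem_filter, mem_filter]
        by_cases hl : l = z
        · subst hl
          rw [hf_z, if_pos haz]
          have h02 : (0 : ZMod 3) ≠ 2 := by decide
          simp [h02]
        · rw [hf_off a l hl]
          simp [hl]
      have hnot : z ∉ (univ : Finset (Fin m)).filter (fun l => a l ≠ 2) := by
        rw [mem_filter]; push Not; intro _; exact haz
      rw [hset, card_insert_of_notMem hnot, Nat.even_add_one]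
    · have hset : (univ : Finset (Fin m)).filter (fun l => a l ≠ 2) =
          insert z ((univ : Finset (Fin m)).filter (fun l => f a l ≠ 2)) := by
        ext l
        rw [mem_insert, mem_filter, mem_filter]
        by_cases hl : l = z
        · subst hl
          rw [hf_z, if_neg haz]
          simp [haz]
        · rw [hf_off a l hl]
          simp [hl]
      have hnot : z ∉ (univ : Finset (Fin m)).filter (fun l => f a l ≠ 2) := by
        rw [mem_filter, hf_z, if_neg haz]; simp
      rw [hset, card_insert_of_notMem hnot, Nat.even_add_one]
      tauto
  have himg : O.image f ⊆ E := by
    intro b hb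
    rw [mem_image] at hb
    obtain ⟨a, ha, rfl⟩ := hb
    rw [hO, mem_filter] at ha
    rw [hE]
    unfold evenCells
    rw [mem_filter]
    exact ⟨mem_univ _, (hflip a).mpr ha.2⟩
  have hfib : ∀ b ∈ O.image f, (O.filter (fun a => f a = b)).card ≤ 2 := by
    intro b _
    have hagree : ∀ a, f a = b → ∀ l, l ≠ z → a l = b l := by
      intro a hfa l hl
      rw [← hfa, hf_off a l hl]
    by_cases hbz : b z = 2
    · have hsub : O.filter (fun a => f a = b) ⊆ {Function.update b z 0, Function.update b z 1} := by
        intro a ha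
        rw [mem_filter] at ha
        obtain ⟨_, hfa⟩ := ha
        have haz : a z ≠ 2 := by
          intro h2
          have h := congrFun hfa z
          rw [hf_z, if_pos h2, hbz] at h
          exact absurd h (by decide)
        have hval : a z = 0 ∨ a z = 1 := by
          have key : ∀ c : ZMod 3, c ≠ 2 → c = 0 ∨ c = 1 := by decide
          exact key _ haz
        rw [mem_insert, mem_singleton]
        rcases hval with h0 | h1
        · left
          funext l
          by_cases hl : l = z
          · subst hl; rw [Function.update_apply, if_pos rfl]; exact h0
          · rw [Function.update_apply, if_neg hl]; exact hagree a hfa l hl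
        · right
          funext l
          by_cases hl : l = z
          · subst hl; rw [Function.update_apply, if_pos rfl]; exact h1
          · rw [Function.update_apply, if_neg hl]; exact hagree a hfa l hl
      exact (card_le_card hsub).trans card_le_two
    · have hsub : O.filter (fun a => f a = b) ⊆ {Function.update b z 2} := by
        intro a ha
        rw [mem_filter] at ha
        obtain ⟨_, hfa⟩ := ha
        have haz : a z = 2 := by
          by_contra h2
          have h := congrFun hfa z
          rw [hf_z, if_neg h2] at h
          exact hbz h.symm
        rw [mem_singleton]
        funext l
        by_cases hl : l = z
        · subst hl; rw [Function.update_apply, if_pos rfl]; exact haz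
        · rw [Function.update_apply, if_neg hl]; exact hagree a hfa l hl
      exact (card_le_card hsub).trans (by simp)
  have hO2 : O.card ≤ 2 * (O.image f).card := card_le_mul_card_image O 2 hfib
  have hOE : O.card ≤ 2 * E.card := hO2.trans (Nat.mul_le_mul_left 2 (card_le_card himg))
  have htot : E.card + O.card = 3 ^ m := by
    have h := Finset.card_filter_add_card_filter_not (s := (univ : Finset (Fin m → ZMod 3)))
      (fun a => Even ((univ : Finset (Fin m)).filter (fun l => a l ≠ 2)).card)
    rw [card_univ, Fintype.card_fun, ZMod.card, Fintype.card_fin] at h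
    rw [hE, hO]
    unfold evenCells
    exact h
  omega

end EvenCells


end Summit.QuantumAdvantage.QuantumAdvantage.Theorems.SparsityDial
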